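import Summits.FinalStateConjecture.FinalStateConjecture.Theorems.EIHFluxBalanceInertialRecessionStubHigherOrderComp
import Summits.FinalStateConjecture.FinalStateConjecture.Theorems.EIHFluxBalanceInertialRecessionStubSlavingCOERCompactBoosts
import Summits.FinalStateConjecture.FinalStateConjecture.Theorems.EIHFluxBalanceInertialRecessionStubSlavingCOERLieKernel
import Summits.FinalStateConjecture.FinalStateConjecture.Theorems.EIHFluxBalanceInertialRecessionAnsatzSmooth

/-!
# Route EIHFluxBalance — `InertialRecession` (E′), line `SketchCleanExcision`, skeleton r13,
# stub `stub_higherOrderSlaving` (EF): body rates of a smooth Lorentz path, to order three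

Helper file for the crux `stmt-FinalStateConjecture-17403`
(`Summit.FinalStateConjecture.FinalStateConjecture.Theses.EIHFluxBalance.InertialRecession`, E′),
registered stub `stub_higherOrderSlaving` (orders two and three of frozen-vacuum slaving).

For a smooth Lorentz path `F = Λ(·)` with inverse path `S = Λ(·)⁻¹` the BODY RATE is
`A = S′ F` (`η`-skew, `minkowski_skew_of_hasDerivAt_lorentz_symm`). This file records the
dictionary between the derivatives of `S` and the body rates, used to put the second and third
lab-time variations of a painted summand into the first-variation form of the coercivity
statement `stub_coerSymbolQuant`:

* `higherOrder_bodyRate_identities` — `S′ = A S`, `S″ = (A′ + A²) S`,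
  `S‴ = (A″ + 2A′A + AA′ + A³) S`; `A`, `A′`, `A″` are `η`-skew; and for every fixed vector `e`
  (`u = F e`): `A e = −S u′`, `A′ e = A²e − S u″`, `A″ e = A′A e + 2AA′e − A³e − S u‴`;
* `higherOrder_bodyRate_norm_le` — `‖A‖ ≤ ‖S′‖‖F‖`, `‖A′‖ ≤ ‖S″‖‖F‖ + ‖S′‖‖F′‖`,
  `‖A″‖ ≤ ‖S‴‖‖F‖ + 2‖S″‖‖F′‖ + ‖S′‖‖F″‖`;
* `higherOrder_exists_inversePath_bounds` — uniformly over Lorentz paths with Lorentz factor `≤ γ`: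
  `‖F‖, ‖S‖ ≤ C`, `‖S′‖ ≤ C‖F′‖`, `‖S″‖ ≤ C(‖F″‖ + ‖F′‖²)`, `‖S‴‖ ≤ C(‖F‴‖ + 3‖F″‖‖F′‖ + ‖F′‖³)`
  (operator inversion is smooth on the compact set of such matrices; chain rule to order three).

No definitions, no named facts, no `sorry`.
-/

set_option linter.dupNamespace false
set_option maxSynthPendingDepth 6
set_option synthInstance.maxHeartbeats 200000

noncomputable section

namespace Summit.FinalStateConjecture.FinalStateConjecture.Theorems.SublinearIsFree.Slaving

open scoped Topology ContDiff
open Filter Set Function Metric Literature.Geometry.Lorentzian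
  Summit.FinalStateConjecture.FinalStateConjecture.Theorems

/-! ### Uniform bounds for the inverse path -/

/-- **Uniform bounds for the inverse path of a Lorentz path with bounded Lorentz factor.**
[folklore] -/
theorem higherOrder_exists_inversePath_bounds (γ : ℝ) : ∃ C : ℝ, 0 ≤ C ∧
    ∀ (Λ : ℝ → lorentzGroup), ContDiff ℝ ∞ (fun t ↦ ((Λ t : E4 ≃L[ℝ] E4) : E4 →L[ℝ] E4)) →
      (∀ t, |((Λ t : E4 ≃L[ℝ] E4) (E4.basisVector 0)) 0| ≤ γ) → ∀ t,
      ‖((Λ t : E4 ≃L[ℝ] E4) : E4 →L[ℝ] E4)‖ ≤ C ∧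
      ‖(((Λ t : E4 ≃L[ℝ] E4).symm : E4 ≃L[ℝ] E4) : E4 →L[ℝ] E4)‖ ≤ C ∧
      ‖deriv (fun s ↦ (((Λ s : E4 ≃L[ℝ] E4).symm : E4 ≃L[ℝ] E4) : E4 →L[ℝ] E4)) t‖ ≤
        C * ‖deriv (fun s ↦ ((Λ s : E4 ≃L[ℝ] E4) : E4 →L[ℝ] E4)) t‖ ∧
      ‖iteratedDeriv 2 (fun s ↦ (((Λ s : E4 ≃L[ℝ] E4).symm : E4 ≃L[ℝ] E4) : E4 →L[ℝ] E4)) t‖ ≤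
        C * (‖iteratedDeriv 2 (fun s ↦ ((Λ s : E4 ≃L[ℝ] E4) : E4 →L[ℝ] E4)) t‖ +
          ‖deriv (fun s ↦ ((Λ s : E4 ≃L[ℝ] E4) : E4 →L[ℝ] E4)) t‖ ^ 2) ∧
      ‖iteratedDeriv 3 (fun s ↦ (((Λ s : E4 ≃L[ℝ] E4).symm : E4 ≃L[ℝ] E4) : E4 →L[ℝ] E4)) t‖ ≤
        C * (‖iteratedDeriv 3 (fun s ↦ ((Λ s : E4 ≃L[ℝ] E4) : E4 →L[ℝ] E4)) t‖ +
          3 * ‖iteratedDeriv 2 (fun s ↦ ((Λ s : E4 ≃L[ℝ] E4) : E4 →L[ℝ] E4)) t‖ *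
            ‖deriv (fun s ↦ ((Λ s : E4 ≃L[ℝ] E4) : E4 →L[ℝ] E4)) t‖ +
          ‖deriv (fun s ↦ ((Λ s : E4 ≃L[ℝ] E4) : E4 →L[ℝ] E4)) t‖ ^ 3) := by
  -- operator inversion is smooth on the open set of invertible operators
  set O : Set (E4 →L[ℝ] E4) := range ((↑) : (E4 ≃L[ℝ] E4) → E4 →L[ℝ] E4) with hO
  have hOo : IsOpen O := ContinuousLinearEquiv.isOpen
  have hinv : ContDiffOn ℝ ∞ (ContinuousLinearMap.inverse : (E4 →L[ℝ] E4) → E4 →L[ℝ] E4) O := by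
    rintro _ ⟨e, rfl⟩
    exact (contDiffAt_map_inverse e).contDiffWithinAt
  set K : Set (E4 →L[ℝ] E4) := {L : E4 →L[ℝ] E4 |
    (∀ v w, Minkowski.bilin (L v) (L w) = Minkowski.bilin v w) ∧ |L (E4.basisVector 0) 0| ≤ γ} with hK
  have hKc : IsCompact K := isCompact_lorentzBounded γ
  have hKO : K ⊆ O := by
    intro L hL
    have hinj := injective_of_minkowski_isometry hL.1
    have hbij : Bijective (L : E4 →ₗ[ℝ] E4) := ⟨hinj, LinearMap.injective_iff_surjective.mp hinj⟩
    exact ⟨(LinearEquiv.ofBijective (L : E4 →ₗ[ℝ] E4) hbij).toContinuousLinearEquiv, by ext v; rfl⟩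
  obtain ⟨C, hC0, hC⟩ := exists_forall_norm_iteratedFDeriv_le_of_isCompact hOo hinv hKc hKO 3
  -- a uniform bound for the norms of the matrices in `K` (and their inverses, which lie in `K`)
  refine ⟨max C (1 + 3 * |γ|), le_max_of_le_left hC0, fun Λ hΛ hγ t ↦ ?_⟩
  have hmem : ∀ t, ((Λ t : E4 ≃L[ℝ] E4) : E4 →L[ℝ] E4) ∈ K := fun t ↦ mem_lorentzBounded (Λ t) (hγ t)
  have hnorm : ∀ L : lorentzGroup, |((L : E4 ≃L[ℝ] E4) (E4.basisVector 0)) 0| ≤ γ →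
      ‖((L : E4 ≃L[ℝ] E4) : E4 →L[ℝ] E4)‖ ≤ max C (1 + 3 * |γ|) := fun L hL ↦
    (norm_lorentz_le L).trans ((by linarith [hL.trans (le_abs_self γ)] :
      1 + 3 * |((L : E4 ≃L[ℝ] E4) (E4.basisVector 0)) 0| ≤ 1 + 3 * |γ|).trans (le_max_right _ _))
  have hF : ‖((Λ t : E4 ≃L[ℝ] E4) : E4 →L[ℝ] E4)‖ ≤ max C (1 + 3 * |γ|) := hnorm (Λ t) (hγ t)
  have hS : ‖(((Λ t : E4 ≃L[ℝ] E4).symm : E4 ≃L[ℝ] E4) : E4 →L[ℝ] E4)‖ ≤ max C (1 + 3 * |γ|) := by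
    have h := hnorm (Λ t)⁻¹ (by rw [coe_lorentz_inv, lorentz_symm_apply_basisVector_zero]; exact hγ t)
    rwa [coe_lorentz_inv] at h
  -- the inverse path is `inverse ∘ F`
  have heq : (fun s ↦ (((Λ s : E4 ≃L[ℝ] E4).symm : E4 ≃L[ℝ] E4) : E4 →L[ℝ] E4)) =
      ContinuousLinearMap.inverse ∘ fun s ↦ ((Λ s : E4 ≃L[ℝ] E4) : E4 →L[ℝ] E4) := by
    funext s; simp only [Function.comp_apply, ContinuousLinearMap.inverse_equiv]
  have hb := higherOrder_norm_deriv_comp₃_le hOo hinv hΛ (hKO (hmem t))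
    (hC _ (hmem t) 1 (by norm_num)) (hC _ (hmem t) 2 (by norm_num)) (hC _ (hmem t) 3 le_rfl)
  rw [← heq] at hb
  obtain ⟨b1, -, -, b2, b3⟩ := hb
  have hCm : C ≤ max C (1 + 3 * |γ|) := le_max_left _ _
  refine ⟨hF, hS, b1.trans ?_, b2.trans ?_, b3.trans ?_⟩
  · exact mul_le_mul_of_nonneg_right hCm (norm_nonneg _)
  · exact mul_le_mul_of_nonneg_right hCm (by positivity)
  · exact mul_le_mul_of_nonneg_right hCm (by positivity)

/-! ### The body rates and their identities -/

set_option maxHeartbeats 3200000 in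
/-- **Body-rate identities of a smooth Lorentz path.** With `F = Λ(·)`, `S = Λ(·)⁻¹` (as operator
paths) and the body rate `A = S′ F`: `S′ = A S`, `S″ = (A′ + A²) S`,
`S‴ = (A″ + 2A′A + AA′ + A³) S`; `A`, `A′`, `A″` are `η`-skew; and for every vector `e` with
`u = F e`: `A e = −S u′`, `A′ e = A(A e) − S u″`, `A″ e = A′(A e) + 2A(A′ e) − A(A(A e)) − S u‴`.
[folklore] -/
theorem higherOrder_bodyRate_identities (Λ : ℝ → lorentzGroup)
    (hΛ : ContDiff ℝ ∞ (fun t ↦ ((Λ t : E4 ≃L[ℝ] E4) : E4 →L[ℝ] E4))) (t : ℝ) :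
    let F : ℝ → E4 →L[ℝ] E4 := fun s ↦ ((Λ s : E4 ≃L[ℝ] E4) : E4 →L[ℝ] E4)
    let S : ℝ → E4 →L[ℝ] E4 := fun s ↦ (((Λ s : E4 ≃L[ℝ] E4).symm : E4 ≃L[ℝ] E4) : E4 →L[ℝ] E4)
    let A : ℝ → E4 →L[ℝ] E4 := fun s ↦ (deriv S s).comp (F s)
    deriv S t = (A t).comp (S t) ∧
    iteratedDeriv 2 S t = (deriv A t + (A t).comp (A t)).comp (S t) ∧
    iteratedDeriv 3 S t = (iteratedDeriv 2 A t + (2 : ℝ) • (deriv A t).comp (A t) +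
      (A t).comp (deriv A t) + ((A t).comp (A t)).comp (A t)).comp (S t) ∧
    (∀ v w, Minkowski.bilin (A t v) w + Minkowski.bilin v (A t w) = 0) ∧
    (∀ v w, Minkowski.bilin (deriv A t v) w + Minkowski.bilin v (deriv A t w) = 0) ∧
    (∀ v w, Minkowski.bilin (iteratedDeriv 2 A t v) w + Minkowski.bilin v (iteratedDeriv 2 A t w) = 0) ∧
    (∀ e : E4, A t e = -S t (deriv (fun s ↦ F s e) t) ∧
      deriv A t e = A t (A t e) - S t (iteratedDeriv 2 (fun s ↦ F s e) t) ∧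
      iteratedDeriv 2 A t e = deriv A t (A t e) + (2 : ℝ) • A t (deriv A t e) - A t (A t (A t e)) -
        S t (iteratedDeriv 3 (fun s ↦ F s e) t)) := by
  intro F S A
  -- smoothness and derivatives
  have hS : ContDiff ℝ ∞ S := contDiff_lorentz_symm hΛ
  have hF : ContDiff ℝ ∞ F := hΛ
  have hS₁c : ContDiff ℝ ∞ (deriv S) := (contDiff_infty_iff_deriv.mp hS).2
  have hA : ContDiff ℝ ∞ A := hS₁c.clm_comp hF
  have hA₁c : ContDiff ℝ ∞ (deriv A) := (contDiff_infty_iff_deriv.mp hA).2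
  have hdS : ∀ s, HasDerivAt S (deriv S s) s := fun s ↦ (hS.differentiable (by simp) s).hasDerivAt
  have hdF : ∀ s, HasDerivAt F (deriv F s) s := fun s ↦ (hF.differentiable (by simp) s).hasDerivAt
  have hdA : ∀ s, HasDerivAt A (deriv A s) s := fun s ↦ (hA.differentiable (by simp) s).hasDerivAt
  have hdA₁ : ∀ s, HasDerivAt (deriv A) (iteratedDeriv 2 A s) s := fun s ↦ by
    have h := higherOrder_hasDerivAt_iteratedDeriv hA 1 s
    rwa [iteratedDeriv_one] at h
  have hdS₁ : ∀ s, HasDerivAt (deriv S) (iteratedDeriv 2 S s) s := fun s ↦ by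
    have h := higherOrder_hasDerivAt_iteratedDeriv hS 1 s
    rwa [iteratedDeriv_one] at h
  have hdS₂ : ∀ s, HasDerivAt (iteratedDeriv 2 S) (iteratedDeriv 3 S s) s := fun s ↦
    higherOrder_hasDerivAt_iteratedDeriv hS 2 s
  have happ : ∀ {B : ℝ → E4 →L[ℝ] E4} {B' : E4 →L[ℝ] E4} {s : ℝ}, HasDerivAt B B' s → ∀ e : E4,
      HasDerivAt (fun r ↦ B r e) (B' e) s := fun hB e ↦ by
    have h := hB.clm_apply (hasDerivAt_const _ e)
    simpa only [map_zero, add_zero] using h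
  -- `S F = 1`, `F S = 1`
  have hSF : ∀ s (v : E4), S s (F s v) = v := fun s v ↦ (Λ s : E4 ≃L[ℝ] E4).symm_apply_apply v
  have hFS : ∀ s (v : E4), F s (S s v) = v := fun s v ↦ (Λ s : E4 ≃L[ℝ] E4).apply_symm_apply v
  -- (1) `S′ = A S` for all `s`
  have h1 : ∀ s, deriv S s = (A s).comp (S s) := fun s ↦ by
    ext v; simp only [ContinuousLinearMap.coe_comp, Function.comp_apply, A, hFS]
  -- (2) `S″ = (A′ + A²) S`
  have h2 : ∀ s, iteratedDeriv 2 S s = (deriv A s + (A s).comp (A s)).comp (S s) := by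
    intro s
    have hprod : HasDerivAt (fun r ↦ (A r).comp (S r))
        ((deriv A s).comp (S s) + (A s).comp (deriv S s)) s := (hdA s).clm_comp (hdS s)
    have heq : deriv S = fun r ↦ (A r).comp (S r) := funext h1
    rw [iteratedDeriv_succ, iteratedDeriv_one, heq, hprod.deriv, h1 s]
    ext v; simp only [_root_.add_apply, ContinuousLinearMap.coe_comp, Function.comp_apply]
  -- (3) `S‴`
  have h3 : iteratedDeriv 3 S t = (iteratedDeriv 2 A t + (2 : ℝ) • (deriv A t).comp (A t) +
      (A t).comp (deriv A t) + ((A t).comp (A t)).comp (A t)).comp (S t) := by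
    have heq : iteratedDeriv 2 S = fun r ↦ (deriv A r + (A r).comp (A r)).comp (S r) := funext h2
    have hin : HasDerivAt (fun r ↦ deriv A r + (A r).comp (A r))
        (iteratedDeriv 2 A t + ((deriv A t).comp (A t) + (A t).comp (deriv A t))) t :=
      (hdA₁ t).add ((hdA t).clm_comp (hdA t))
    have hprod := hin.clm_comp (hdS t)
    rw [iteratedDeriv_succ, heq, hprod.deriv, h1 t]
    ext v
    simp only [_root_.add_apply, ContinuousLinearMap.coe_comp, Function.comp_apply, two_smul]
    abel
  -- (4) skewness of `A`, then of `A′`, `A″` by differentiation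
  have hskew : ∀ s (v w : E4), Minkowski.bilin (A s v) w + Minkowski.bilin v (A s w) = 0 :=
    fun s v w ↦ minkowski_skew_of_hasDerivAt_lorentz_symm (hdS s) v w
  have hskew_deriv : ∀ {B : ℝ → E4 →L[ℝ] E4} {B' : E4 →L[ℝ] E4} (s : ℝ), HasDerivAt B B' s →
      (∀ r (v w : E4), Minkowski.bilin (B r v) w + Minkowski.bilin v (B r w) = 0) →
      ∀ v w : E4, Minkowski.bilin (B' v) w + Minkowski.bilin v (B' w) = 0 := by
    intro B B' s hB hBs v w
    have hv : HasDerivAt (fun r ↦ B r v) (B' v) s := happ hB v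
    have hw : HasDerivAt (fun r ↦ B r w) (B' w) s := happ hB w
    have h1' : HasDerivAt (fun r ↦ Minkowski.bilin (B r v) w) (Minkowski.bilin (B' v) w) s := by
      have hc : HasDerivAt (fun r ↦ (Minkowski.bilin : E4 →L[ℝ] E4 →L[ℝ] ℝ) (B r v))
          ((Minkowski.bilin : E4 →L[ℝ] E4 →L[ℝ] ℝ) (B' v)) s :=
        (Minkowski.bilin : E4 →L[ℝ] E4 →L[ℝ] ℝ).hasFDerivAt.comp_hasDerivAt s hv
      have h := hc.clm_apply (hasDerivAt_const s w)
      simpa only [map_zero, add_zero] using h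
    have h2' : HasDerivAt (fun r ↦ Minkowski.bilin v (B r w)) (Minkowski.bilin v (B' w)) s :=
      ((Minkowski.bilin : E4 →L[ℝ] E4 →L[ℝ] ℝ) v).hasFDerivAt.comp_hasDerivAt s hw
    have hsum : HasDerivAt (fun r ↦ Minkowski.bilin (B r v) w + Minkowski.bilin v (B r w))
        (Minkowski.bilin (B' v) w + Minkowski.bilin v (B' w)) s := h1'.add h2'
    have hconst : (fun r ↦ Minkowski.bilin (B r v) w + Minkowski.bilin v (B r w)) = fun _ ↦ (0 : ℝ) :=
      funext fun r ↦ hBs r v w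
    rw [hconst] at hsum
    exact hsum.unique (hasDerivAt_const s (0 : ℝ))
  have hskew' : ∀ s (v w : E4), Minkowski.bilin (deriv A s v) w + Minkowski.bilin v (deriv A s w) = 0 :=
    fun s ↦ hskew_deriv s (hdA s) hskew
  have hskew'' : ∀ v w : E4, Minkowski.bilin (iteratedDeriv 2 A t v) w +
      Minkowski.bilin v (iteratedDeriv 2 A t w) = 0 := hskew_deriv t (hdA₁ t) hskew'
  -- (5) column identities for a fixed vector `e`
  have hcol : ∀ e : E4, A t e = -S t (deriv (fun s ↦ F s e) t) ∧
      deriv A t e = A t (A t e) - S t (iteratedDeriv 2 (fun s ↦ F s e) t) ∧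
      iteratedDeriv 2 A t e = deriv A t (A t e) + (2 : ℝ) • A t (deriv A t e) - A t (A t (A t e)) -
        S t (iteratedDeriv 3 (fun s ↦ F s e) t) := by
    intro e
    set u : ℝ → E4 := fun s ↦ F s e with hu
    have huc : ContDiff ℝ ∞ u := hF.clm_apply contDiff_const
    have hdu : ∀ s, HasDerivAt u (deriv u s) s := fun s ↦ (huc.differentiable (by simp) s).hasDerivAt
    have hdu₁ : ∀ s, HasDerivAt (deriv u) (iteratedDeriv 2 u s) s := fun s ↦ by
      have h := higherOrder_hasDerivAt_iteratedDeriv huc 1 s; rwa [iteratedDeriv_one] at h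
    have hdu₂ : ∀ s, HasDerivAt (iteratedDeriv 2 u) (iteratedDeriv 3 u s) s := fun s ↦
      higherOrder_hasDerivAt_iteratedDeriv huc 2 s
    -- `S u = e` is constant: `S′ u + S u′ = 0`, i.e. `A e = −S u′` (for all `s`)
    have hSu : ∀ s, S s (u s) = e := fun s ↦ hSF s e
    have hAe_def : ∀ s, A s e = deriv S s (u s) := fun s ↦ rfl
    have hdS_apply : ∀ s (X : E4), deriv S s X = A s (S s X) := fun s X ↦ by
      rw [h1 s]; rfl
    have hI : ∀ s, A s e = -S s (deriv u s) := by
      intro s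
      have hprod : HasDerivAt (fun r ↦ S r (u r)) (deriv S s (u s) + S s (deriv u s)) s :=
        (hdS s).clm_apply (hdu s)
      have hconst : (fun r ↦ S r (u r)) = fun _ ↦ e := funext hSu
      rw [hconst] at hprod
      have h0 := hprod.unique (hasDerivAt_const s e)
      rw [hAe_def]; exact eq_neg_of_add_eq_zero_left h0
    -- differentiate `A e = −S u′`
    have hII : ∀ s, deriv A s e = A s (A s e) - S s (iteratedDeriv 2 u s) := by
      intro s
      have hl : HasDerivAt (fun r ↦ A r e) (deriv A s e) s := happ (hdA s) e
      have hr : HasDerivAt (fun r ↦ -S r (deriv u r)) (-(deriv S s (deriv u s) + S s (iteratedDeriv 2 u s))) s :=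
        ((hdS s).clm_apply (hdu₁ s)).neg
      have heq : (fun r ↦ A r e) = fun r ↦ -S r (deriv u r) := funext hI
      rw [heq] at hl
      have h := hl.unique hr
      have hSu' : S s (deriv u s) = -A s e := by rw [hI s, neg_neg]
      rw [h, hdS_apply s, hSu', map_neg]
      abel
    -- differentiate once more
    have hIII : iteratedDeriv 2 A t e = deriv A t (A t e) + (2 : ℝ) • A t (deriv A t e) -
        A t (A t (A t e)) - S t (iteratedDeriv 3 u t) := by
      have hl : HasDerivAt (fun r ↦ deriv A r e) (iteratedDeriv 2 A t e) t := happ (hdA₁ t) e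
      have hAe : HasDerivAt (fun r ↦ A r e) (deriv A t e) t := happ (hdA t) e
      have hAAe : HasDerivAt (fun r ↦ A r (A r e)) (deriv A t (A t e) + A t (deriv A t e)) t :=
        (hdA t).clm_apply hAe
      have hSu₂ : HasDerivAt (fun r ↦ S r (iteratedDeriv 2 u r))
          (deriv S t (iteratedDeriv 2 u t) + S t (iteratedDeriv 3 u t)) t := (hdS t).clm_apply (hdu₂ t)
      have hr := hAAe.sub hSu₂
      have heq : (fun r ↦ deriv A r e) = fun r ↦ A r (A r e) - S r (iteratedDeriv 2 u r) := funext hII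
      rw [heq] at hl
      have h := hl.unique hr
      have hSu₂' : S t (iteratedDeriv 2 u t) = A t (A t e) - deriv A t e := by
        have := hII t; rw [this]; abel
      rw [h, hdS_apply t, hSu₂', map_sub, two_smul]
      abel
    exact ⟨hI t, hII t, hIII⟩
  exact ⟨h1 t, h2 t, h3, hskew t, hskew' t, hskew'', hcol⟩

/-- **Norms of the body rates through the derivatives of `S` and `F`.** [folklore] -/
theorem higherOrder_bodyRate_norm_le (Λ : ℝ → lorentzGroup)
    (hΛ : ContDiff ℝ ∞ (fun t ↦ ((Λ t : E4 ≃L[ℝ] E4) : E4 →L[ℝ] E4))) (t : ℝ) :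
    let F : ℝ → E4 →L[ℝ] E4 := fun s ↦ ((Λ s : E4 ≃L[ℝ] E4) : E4 →L[ℝ] E4)
    let S : ℝ → E4 →L[ℝ] E4 := fun s ↦ (((Λ s : E4 ≃L[ℝ] E4).symm : E4 ≃L[ℝ] E4) : E4 →L[ℝ] E4)
    let A : ℝ → E4 →L[ℝ] E4 := fun s ↦ (deriv S s).comp (F s)
    ‖A t‖ ≤ ‖deriv S t‖ * ‖F t‖ ∧
    ‖deriv A t‖ ≤ ‖iteratedDeriv 2 S t‖ * ‖F t‖ + ‖deriv S t‖ * ‖deriv F t‖ ∧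
    ‖iteratedDeriv 2 A t‖ ≤ ‖iteratedDeriv 3 S t‖ * ‖F t‖ + 2 * (‖iteratedDeriv 2 S t‖ * ‖deriv F t‖) +
      ‖deriv S t‖ * ‖iteratedDeriv 2 F t‖ := by
  intro F S A
  have hS : ContDiff ℝ ∞ S := contDiff_lorentz_symm hΛ
  have hF : ContDiff ℝ ∞ F := hΛ
  have hS₁c : ContDiff ℝ ∞ (deriv S) := (contDiff_infty_iff_deriv.mp hS).2
  have hF₁c : ContDiff ℝ ∞ (deriv F) := (contDiff_infty_iff_deriv.mp hF).2
  have hA : ContDiff ℝ ∞ A := hS₁c.clm_comp hF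
  have hdF : ∀ s, HasDerivAt F (deriv F s) s := fun s ↦ (hF.differentiable (by simp) s).hasDerivAt
  have hdF₁ : ∀ s, HasDerivAt (deriv F) (iteratedDeriv 2 F s) s := fun s ↦ by
    have h := higherOrder_hasDerivAt_iteratedDeriv hF 1 s; rwa [iteratedDeriv_one] at h
  have hdS₁ : ∀ s, HasDerivAt (deriv S) (iteratedDeriv 2 S s) s := fun s ↦ by
    have h := higherOrder_hasDerivAt_iteratedDeriv hS 1 s; rwa [iteratedDeriv_one] at h
  have hdS₂ : ∀ s, HasDerivAt (iteratedDeriv 2 S) (iteratedDeriv 3 S s) s := fun s ↦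
    higherOrder_hasDerivAt_iteratedDeriv hS 2 s
  -- `A′ = S″ F + S′ F′` for all `s`, and `A″` at `t`
  have hA1 : ∀ s, HasDerivAt A ((iteratedDeriv 2 S s).comp (F s) + (deriv S s).comp (deriv F s)) s :=
    fun s ↦ (hdS₁ s).clm_comp (hdF s)
  have hA1eq : deriv A = fun s ↦ (iteratedDeriv 2 S s).comp (F s) + (deriv S s).comp (deriv F s) :=
    funext fun s ↦ (hA1 s).deriv
  have hA2 : HasDerivAt (deriv A) (((iteratedDeriv 3 S t).comp (F t) + (iteratedDeriv 2 S t).comp (deriv F t)) +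
      ((iteratedDeriv 2 S t).comp (deriv F t) + (deriv S t).comp (iteratedDeriv 2 F t))) t := by
    rw [hA1eq]
    exact ((hdS₂ t).clm_comp (hdF t)).add ((hdS₁ t).clm_comp (hdF₁ t))
  have hA2eq : iteratedDeriv 2 A t = ((iteratedDeriv 3 S t).comp (F t) + (iteratedDeriv 2 S t).comp (deriv F t)) +
      ((iteratedDeriv 2 S t).comp (deriv F t) + (deriv S t).comp (iteratedDeriv 2 F t)) := by
    rw [iteratedDeriv_succ, iteratedDeriv_one, hA2.deriv]
  refine ⟨ContinuousLinearMap.opNorm_comp_le _ _, ?_, ?_⟩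
  · rw [hA1eq]
    exact (norm_add_le _ _).trans (add_le_add (ContinuousLinearMap.opNorm_comp_le _ _)
      (ContinuousLinearMap.opNorm_comp_le _ _))
  · rw [hA2eq]
    calc _ ≤ (‖(iteratedDeriv 3 S t).comp (F t)‖ + ‖(iteratedDeriv 2 S t).comp (deriv F t)‖) +
          (‖(iteratedDeriv 2 S t).comp (deriv F t)‖ + ‖(deriv S t).comp (iteratedDeriv 2 F t)‖) :=
          (norm_add_le _ _).trans (add_le_add (norm_add_le _ _) (norm_add_le _ _))
      _ ≤ (‖iteratedDeriv 3 S t‖ * ‖F t‖ + ‖iteratedDeriv 2 S t‖ * ‖deriv F t‖) +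
          (‖iteratedDeriv 2 S t‖ * ‖deriv F t‖ + ‖deriv S t‖ * ‖iteratedDeriv 2 F t‖) := by
          gcongr <;> exact ContinuousLinearMap.opNorm_comp_le _ _
      _ = _ := by ring

/-- **Registered one-line carrier form** (`higherOrder_bodyRates_EF`) of
`higherOrder_bodyRate_identities`. [folklore] -/
theorem higherOrder_bodyRates_EF : open Literature.Geometry.Lorentzian in ∀ (Λ : ℝ → lorentzGroup), ContDiff ℝ ((⊤ : ℕ∞) : WithTop ℕ∞) (fun t ↦ ((Λ t : E4 ≃L[ℝ] E4) : E4 →L[ℝ] E4)) → ∀ (t : ℝ), let F : ℝ → E4 →L[ℝ] E4 := fun s ↦ ((Λ s : E4 ≃L[ℝ] E4) : E4 →L[ℝ] E4); let S : ℝ → E4 →L[ℝ] E4 := fun s ↦ (((Λ s : E4 ≃L[ℝ] E4).symm : E4 ≃L[ℝ] E4) : E4 →L[ℝ] E4); let A : ℝ → E4 →L[ℝ] E4 := fun s ↦ (deriv S s).comp (F s); deriv S t = (A t).comp (S t) ∧ iteratedDeriv 2 S t = (deriv A t + (A t).comp (A t)).comp (S t) ∧ iteratedDeriv 3 S t = (iteratedDeriv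 2 A t + (2 : ℝ) • (deriv A t).comp (A t) + (A t).comp (deriv A t) + ((A t).comp (A t)).comp (A t)).comp (S t) ∧ (∀ v w, Minkowski.bilin (A t v) w + Minkowski.bilin v (A t w) = 0) ∧ (∀ v w, Minkowski.bilin (deriv A t v) w + Minkowski.bilin v (deriv A t w) = 0) ∧ (∀ v w, Minkowski.bilin (iteratedDeriv 2 A t v) w + Minkowski.bilin v (iteratedDeriv 2 A t w) = 0) ∧ (∀ e : E4, A t e = -S t (deriv (fun s ↦ F s e) t) ∧ deriv A t e = A t (A t e) - S t (iteratedDeriv 2 (fun s ↦ F s e) t) ∧ iteratedDeriv 2 A t e = deriv A t (A t e) + (2 : ℝ) • A t (deriv A t e) - A t (A t (A t e)) - S t (iteratedDeriv 3 (fun s ↦ F s e) t)) :=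
  fun Λ hΛ t ↦ higherOrder_bodyRate_identities Λ hΛ t

end Summit.FinalStateConjecture.FinalStateConjecture.Theorems.SublinearIsFree.Slaving

end
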